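import Literature.NumberTheory.LFunctions.Zhang2022.Section10Lemma102Mellin
import Literature.NumberTheory.LFunctions.Zhang2022.Section7XiZeroSummable
import HarnessLib

/-!
# Zhang (2022) §10: `Z22:§10.u018` holds unconditionally

Cell `siegel-zhang` (D-0069 width campaign), layer L3 node `Z22:§10.u018` [Z22 p.55, tex L2824]
(proof of Lemma 10.2: "By (8.9) and (10.6), `𝔳₂ⱼ(d,r) = (500/log P)·(1/2πi)∫_{(1)}
L(1+β_{j+1}+s,χ)L(1+β_{j+2}+s,χ)𝔲₀ⱼ(s;d,r)L(1+s,χ)⁻¹ ((P′₁)^s − 2(P′₂)^s + (P′₃)^s)(dr)^{−s} ds/s²`")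
of Y. Zhang, arXiv:2211.02515v1 [Zhang2022LandauSiegel] (an unrefereed manuscript under adjudication;
nothing here concerns its Theorems 1–2). The typed node `Typed.Sec10A.Step10u018 c′`
(`TypedSection10A`, L3-t1) was reduced by `Typed.Sec10A.step10u018_of_summable`
(`Section10Lemma102Mellin`, L3-t1) to the absolute convergence of `Σ_n χ(n)ξ₀ⱼ(n;d,r)n^{−s}` on
`Re s = 2`; that convergence is the tree's `XiZeroSummable.summable_norm_xiZero_div_sq`
(`Section7XiZeroSummable`, every modulus). This file composes the two: `step10u018_holds`.
[cite: Zhang2022LandauSiegel, §10 p.55]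
-/

namespace Literature.NumberTheory.LFunctions.Zhang2022.Section10Step10u018

/-- **`Z22:§10.u018` DISCHARGED** [Z22 p.55, tex L2824]: the typed node `Typed.Sec10A.Step10u018 c′`
holds for every `c′` — L3-t1's edge `Typed.Sec10A.step10u018_of_summable` fed with the absolute
convergence `XiZeroSummable.summable_norm_xiZero_div_sq` (valid for every modulus, so the
`ForAllLarge` threshold is `0`). [cite: Zhang2022LandauSiegel, §10 proof of Lemma 10.2 p.55] -/
theorem step10u018_holds (c' : ℝ) : Typed.Sec10A.Step10u018 c' :=
  Typed.Sec10A.step10u018_of_summable c'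
    ⟨0, fun _ _ χ _ _ _ j _ d r _ _ => XiZeroSummable.summable_norm_xiZero_div_sq c' χ j d r⟩

variable (c' : ℝ) in
/-- `Step10u018` — `_holds` alias of `step10u018_holds` above under the fact's exact name, stated under the
prover's own binders as section variables (appended 2026-08-28, D-0026 bookkeeping: the proof term is the
existing theorem of this file; no statement, definition or attribute is edited; no new named fact; the
ledger's debt table listed the fact unproved). [cite: Zhang2022LandauSiegel, §10 proof of Lemma 10.2 p.55] -/
theorem _root_.Literature.NumberTheory.LFunctions.Zhang2022.Typed.Sec10A.Step10u018_holds :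
    _root_.Literature.NumberTheory.LFunctions.Zhang2022.Typed.Sec10A.Step10u018 c' :=
  _root_.Literature.NumberTheory.LFunctions.Zhang2022.Section10Step10u018.step10u018_holds (c' := c')

end Literature.NumberTheory.LFunctions.Zhang2022.Section10Step10u018
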